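import Summits.ABC.ABC.Theses.RibetTakahashiSplit

/-!
# STRATEGY-CENSUS §Decomposition, split Σ1 (Δ-part / c₄-part) — typed, glue proved (not filed)

Crux-strategist seat `planner-cstrat-stmt-ABC-17927-p1-0`, 2026-08-17.  The best typed split of r3″ found:
`SubDelta` (thin weighted Szpiro for the discriminant alone) and `SubC4` (thin weighted Szpiro for `c₄³`
alone), with the glue `SubDelta → SubC4 → ThinWeightedSzpiro` proved (θ := min θ₁ θ₂, C := max C₁ C₂).
It is NOT filed as a route split: on every Frey model `|Δ_min| < |c₄|³`, so `SubC4` alone carries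
everything `closes` uses and is the Hall-complete piece (`FreyHallKernel.hallOnClass_of_thinFrey`);
see STRATEGY-CENSUS.md §Decomposition.
-/

noncomputable section

set_option linter.dupNamespace false

namespace Summit.ABC.ABC.Cruxes.ThinWeightedSzpiro.CensusSplits

open IsDedekindDomain WeierstrassCurve
open Summit.ABC.ABC.Theses.RibetTakahashiSplit

/-- The body of r3″ at class exponent `θ` with the left-hand side replaced by `F W₀`. -/
def ThinBody (F : WeierstrassCurve ℤ → ℤ) (θ : ℝ) : Prop :=
  ∀ ε : ℝ, 0 < ε → ∀ K : ℝ, ∃ C : ℝ, ∀ W₀ : WeierstrassCurve ℤ,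
    (W₀.baseChange ℚ).IsElliptic →
    (∀ v : HeightOneSpectrum ℤ, (W₀.baseChange ℚ).IsMinimalAt v) →
    (∀ p : ℕ, p.Prime → p ≠ 2 → ¬ p ^ 2 ∣ (W₀.baseChange ℚ).conductorNorm ℤ) →
    ((∏ p ∈ ((W₀.baseChange ℚ).conductorNorm ℤ).primeFactors with
          ¬ p ^ 2 ∣ (W₀.baseChange ℚ).conductorNorm ℤ,
        ((W₀.baseChange ℚ).minimalDiscriminantNorm ℤ).factorization p : ℕ) : ℝ) ≤
      K * (((W₀.baseChange ℚ).conductorNorm ℤ : ℕ) : ℝ) ^ θ →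
    ((F W₀ : ℤ) : ℝ) ≤
      C * ((((W₀.baseChange ℚ).conductorNorm ℤ : ℕ) : ℝ) *
        ((∏ p ∈ ((W₀.baseChange ℚ).conductorNorm ℤ).primeFactors with
            ¬ p ^ 2 ∣ (W₀.baseChange ℚ).conductorNorm ℤ,
          ((W₀.baseChange ℚ).minimalDiscriminantNorm ℤ).factorization p : ℕ) : ℝ)) ^ (6 + ε)

/-- Σ1, piece 1: thin weighted Szpiro for the DISCRIMINANT alone (Hall-free: trivial on the Hall family). -/
def SubDelta : Prop := ∃ θ : ℝ, 0 < θ ∧ ThinBody (fun W₀ ↦ |W₀.Δ|) θ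

/-- Σ1, piece 2: thin weighted Szpiro for `c₄³` alone (the Hall-complete piece; = the whole crux on Frey models). -/
def SubC4 : Prop := ∃ θ : ℝ, 0 < θ ∧ ThinBody (fun W₀ ↦ |W₀.c₄| ^ 3) θ

/-- The crux is `ThinBody max` for some `θ > 0`. -/
theorem crux_iff : ThinWeightedSzpiro ↔ ∃ θ : ℝ, 0 < θ ∧ ThinBody (fun W₀ ↦ max |W₀.Δ| (|W₀.c₄| ^ 3)) θ :=
  Iff.rfl

/-- `ThinBody F` is antitone in the class exponent: a smaller class is easier to serve. [folklore] -/
theorem thinBody_antitone {F : WeierstrassCurve ℤ → ℤ} {θ θ' : ℝ} (hθ : θ ≤ θ') (h : ThinBody F θ') :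
    ThinBody F θ := by
  intro ε hε K
  obtain ⟨C, hC⟩ := h ε hε (max K 0)
  refine ⟨C, fun W₀ hE hmin hss hthin ↦ hC W₀ hE hmin hss ?_⟩
  have hN1 : (1 : ℝ) ≤ (((W₀.baseChange ℚ).conductorNorm ℤ : ℕ) : ℝ) := by
    haveI := hE
    exact_mod_cast WeierstrassCurve.conductorNorm_pos_holds (W₀.baseChange ℚ)
  calc _ ≤ K * (((W₀.baseChange ℚ).conductorNorm ℤ : ℕ) : ℝ) ^ θ := hthin
    _ ≤ max K 0 * (((W₀.baseChange ℚ).conductorNorm ℤ : ℕ) : ℝ) ^ θ :=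
        mul_le_mul_of_nonneg_right (le_max_left _ _) (Real.rpow_nonneg (by positivity) _)
    _ ≤ max K 0 * (((W₀.baseChange ℚ).conductorNorm ℤ : ℕ) : ℝ) ^ θ' :=
        mul_le_mul_of_nonneg_left (Real.rpow_le_rpow_of_exponent_le hN1 hθ) (le_max_right _ _)

/-- **Glue of Σ1**: `SubDelta → SubC4 → ThinWeightedSzpiro` (provable now; 20 lines). [folklore] -/
theorem crux_of_subs (hΔ : SubDelta) (h4 : SubC4) : ThinWeightedSzpiro := by
  obtain ⟨θ₁, hθ₁, hT₁⟩ := hΔ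
  obtain ⟨θ₂, hθ₂, hT₂⟩ := h4
  refine ⟨min θ₁ θ₂, lt_min hθ₁ hθ₂, fun ε hε K ↦ ?_⟩
  obtain ⟨C₁, hC₁⟩ := thinBody_antitone (min_le_left θ₁ θ₂) hT₁ ε hε K
  obtain ⟨C₂, hC₂⟩ := thinBody_antitone (min_le_right θ₁ θ₂) hT₂ ε hε K
  refine ⟨max C₁ C₂, fun W₀ hE hmin hss hthin ↦ ?_⟩
  have h1 := hC₁ W₀ hE hmin hss hthin
  have h2 := hC₂ W₀ hE hmin hss hthin
  have hpow : (0 : ℝ) ≤ ((((W₀.baseChange ℚ).conductorNorm ℤ : ℕ) : ℝ) *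
      ((∏ p ∈ ((W₀.baseChange ℚ).conductorNorm ℤ).primeFactors with
          ¬ p ^ 2 ∣ (W₀.baseChange ℚ).conductorNorm ℤ,
        ((W₀.baseChange ℚ).minimalDiscriminantNorm ℤ).factorization p : ℕ) : ℝ)) ^ (6 + ε) :=
    Real.rpow_nonneg (by positivity) _
  rcases le_total |W₀.Δ| (|W₀.c₄| ^ 3) with hle | hle
  · rw [max_eq_right hle]
    exact h2.trans (mul_le_mul_of_nonneg_right (le_max_right _ _) hpow)
  · rw [max_eq_left hle]
    exact h1.trans (mul_le_mul_of_nonneg_right (le_max_left _ _) hpow)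

/-- Conversely each piece is a restriction of the crux. [folklore] -/
theorem subs_of_crux (h : ThinWeightedSzpiro) : SubDelta ∧ SubC4 := by
  obtain ⟨θ, hθ, hT⟩ := h
  refine ⟨⟨θ, hθ, fun ε hε K ↦ ?_⟩, ⟨θ, hθ, fun ε hε K ↦ ?_⟩⟩
  · obtain ⟨C, hC⟩ := hT ε hε K
    refine ⟨C, fun W₀ hE hmin hss hthin ↦ le_trans ?_ (hC W₀ hE hmin hss hthin)⟩
    exact_mod_cast le_max_left _ _
  · obtain ⟨C, hC⟩ := hT ε hε K
    refine ⟨C, fun W₀ hE hmin hss hthin ↦ le_trans ?_ (hC W₀ hE hmin hss hthin)⟩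
    exact_mod_cast le_max_right _ _

end Summit.ABC.ABC.Cruxes.ThinWeightedSzpiro.CensusSplits

end
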